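import Literature.MathematicalPhysics.KineticTheory.LanfordPicard
import HarnessLib

/-!
# Local existence of mild hard-sphere Boltzmann solutions in Lanford's class (torus)

(Topic MathematicalPhysics/KineticTheory; fifth layer of the proof of the named fact
`Literature.MathematicalPhysics.KineticTheory.ukai_lanford_bound`.)

**Theorem** (`hardSphere_mild_exists`). For `β₀ > 0` and `K > 0` there is a time
`T = T(d, β₀, K) > 0` such that every continuous datum `0 ≤ f₀ ≤ K e^{-β₀|v|²/2}` on
`T^d × ℝ^d` launches a mild solution `u` of the hard-sphere Boltzmann equation on `[0, T]`
(`Literature.Analysis.FluidPDE.IsMildBoltzmannSolutionOn T (Torus.geometry d) hardSphereKernel u`)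
with `u(0) = f₀`, continuous time slices, and `|u(t, x, v)| ≤ 2K e^{-(β₀/2)|v|²/2}`.

This is the existence half of Gallagher–Saint-Raymond–Texier 2013, Part I Ch. 2 §3.1 Thm 1
(local existence of continuous solutions with Gaussian velocity decay, lifespan
`T = C_β / ‖f₀ e^{β|v|²/2}‖_∞`), proved as in Part II Ch. 5 (Thm 7 for the hierarchy) by a
Picard iteration in the scale of weighted spaces `β(t) = β₀ - λt`, `λ = β₀/(2T)` (Ukai 1974).
Positivity is obtained by iterating the sign-corrected operator
`Q̃(p) = ∫∫ B (|p'| |p_*'| - p |p_*|)` (Kaniel–Shinbrot 1978): a continuous fixed point `u` of the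
corresponding Duhamel map is nonnegative — at a first time where `u♯ < 0` on a characteristic
the integrand `Q̃♯ ≥ 0` forces `u♯` to increase (`picard_fixedPoint_nonneg`) — and then
`Q̃(u) = Q(u, u)`, so `u` is a mild solution (`picard_fixedPoint_isMild`).

Contents: `picard_iterate_bounds` (the iterates `Φⁿ(0)` stay in the ball
`|u| ≤ 2K e^{-β(t)|v|²/2}` and contract geometrically, from `abs_picard_le`,
`abs_picard_sub_picard_le`), `picard_fixedPoint_exists` (uniform limit, continuity, fixed
point), `picard_fixedPoint_nonneg`, `picard_fixedPoint_isMild`, `hardSphere_mild_exists`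
(choice of `T`: `16 |S^{d-1}| J(β₀/2) K (1 + (4/β₀)^{1/2}) T ≤ 1`).

No definitions are introduced (the Picard map enters through a characterising hypothesis
`hΦ : ∀ u t y v, Φ u t y v = …`, discharged by `rfl`).

## References

* I. Gallagher, L. Saint-Raymond, B. Texier, *From Newton to Boltzmann: hard spheres and
  short-range potentials*, EMS (2013) = arXiv:1208.5753, Part I Ch. 2 §3.1 Thm 1, Part II
  Ch. 5 Thm 7, Remark 5.1.5.
* S. Ukai, Proc. Japan Acad. 50 (1974) 179–184.
* S. Kaniel, M. Shinbrot, *The Boltzmann equation. I. Uniqueness and local existence*,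
  Comm. Math. Phys. 58 (1978) 65–84.
-/

open MeasureTheory Metric Real Set Filter Topology
open scoped InnerProductSpace ENNReal
open Literature.Analysis.FluidPDE

namespace Literature.MathematicalPhysics.KineticTheory

noncomputable section

section Existence

variable {d : Type*} [Fintype d]

/-- **The Picard iterates stay in the weighted ball and contract** (GST 2013 Part II Ch. 5,
proof of Thm 7, for the equation). With `T, λ = β₀/(2T)`, `β(t) = β₀ - λ t'` as in
`abs_picard_le`, if `‖f₀‖_{β₀} ≤ K_f`, `K_f + 4|S| J R² ε ≤ R` and `4|S| J R ε ≤ 1/2`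
(`ε = T + (2T/λ)^{1/2}`), then every iterate `uₙ = Φⁿ(0)` is jointly continuous,
`|uₙ(t)| ≤ R e^{-β(t)|v|²/2}` and `|uₙ₊₁(t) - uₙ(t)| ≤ R 2⁻ⁿ e^{-β(t)|v|²/2}`. [cite: GST2013, Part II Ch. 5 Thm 7] -/
theorem picard_iterate_bounds
    {Qa : (EuclideanSpace ℝ d → ℝ) → EuclideanSpace ℝ d → ℝ}
    (hQa : ∀ p v, Qa p v = ∫ w, ∫ ω, hardSphereKernel (v, w) ω *
      (|p (collide ω (v, w)).1| * |p (collide ω (v, w)).2| - p v * |p w|) ∂sphereMeasure)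
    {T β₀ lam R Kf : ℝ} (hT : 0 < T) (hβ₀ : 0 < β₀) (hlam : lam = β₀ / (2 * T)) (hR : 0 ≤ R)
    {f₀ : UnitAddTorus d → EuclideanSpace ℝ d → ℝ} (hf₀c : Continuous (Function.uncurry f₀))
    (hf₀b : ∀ y v, |f₀ y v| ≤ Kf * exp (-(β₀ / 2) * ‖v‖ ^ 2))
    (hsmall₁ : Kf + 4 * (sphereMeasure : Measure (sphere (0 : EuclideanSpace ℝ d) 1)).real univ *
        (∫ x : EuclideanSpace ℝ d, (1 + ‖x‖) * exp (-(β₀ / 2 / 2) * ‖x‖ ^ 2)) * R * R *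
        (T + Real.sqrt (2 * T / lam)) ≤ R)
    (hsmall₂ : 4 * (sphereMeasure : Measure (sphere (0 : EuclideanSpace ℝ d) 1)).real univ *
        (∫ x : EuclideanSpace ℝ d, (1 + ‖x‖) * exp (-(β₀ / 2 / 2) * ‖x‖ ^ 2)) * R *
        (T + Real.sqrt (2 * T / lam)) ≤ 1 / 2)
    {Φ : (ℝ → UnitAddTorus d → EuclideanSpace ℝ d → ℝ) → ℝ → UnitAddTorus d →
      EuclideanSpace ℝ d → ℝ}
    (hΦ : ∀ u t y v, Φ u t y v =
      f₀ (y - Literature.Analysis.FunctionSpaces.Torus.proj (max 0 (min T t) • v)) v +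
        ∫ τ in (0 : ℝ)..max 0 (min T t),
          Qa (u τ (y - Literature.Analysis.FunctionSpaces.Torus.proj
            ((max 0 (min T t) - τ) • v))) v)
    (n : ℕ) :
    Continuous (fun z : ℝ × UnitAddTorus d × EuclideanSpace ℝ d =>
        (Φ^[n] 0) z.1 z.2.1 z.2.2) ∧
      (∀ t y v, |(Φ^[n] 0) t y v| ≤
        R * exp (-((β₀ - lam * max 0 (min T t)) / 2) * ‖v‖ ^ 2)) ∧
      (∀ t y v, |(Φ^[n + 1] 0) t y v - (Φ^[n] 0) t y v| ≤
        R * (1 / 2) ^ n * exp (-((β₀ - lam * max 0 (min T t)) / 2) * ‖v‖ ^ 2)) := by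
  have hlam0 : 0 < lam := by rw [hlam]; positivity
  have hwlo : ∀ s : ℝ, β₀ / 2 ≤ β₀ - lam * max 0 (min T s) := fun s => by
    have hlamT : lam * T = β₀ / 2 := by rw [hlam]; field_simp
    have h1 : max 0 (min T s) ≤ T := max_le hT.le (min_le_left _ _)
    nlinarith [mul_le_mul_of_nonneg_left h1 hlam0.le]
  -- the global weaker bound, for the continuity lemma
  have hweak : ∀ {g : ℝ → UnitAddTorus d → EuclideanSpace ℝ d → ℝ},
      (∀ t y v, |g t y v| ≤ R * exp (-((β₀ - lam * max 0 (min T t)) / 2) * ‖v‖ ^ 2)) →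
      ∀ s z x, |g s z x| ≤ R * exp (-(β₀ / 2 / 2) * ‖x‖ ^ 2) := by
    intro g hg s z x
    refine (hg s z x).trans (mul_le_mul_of_nonneg_left (exp_le_exp.2 ?_) hR)
    nlinarith [sq_nonneg ‖x‖, hwlo s]
  -- continuity and the ball, by induction
  have hcb : ∀ n : ℕ,
      Continuous (fun z : ℝ × UnitAddTorus d × EuclideanSpace ℝ d =>
        (Φ^[n] 0) z.1 z.2.1 z.2.2) ∧
      (∀ t y v, |(Φ^[n] 0) t y v| ≤
        R * exp (-((β₀ - lam * max 0 (min T t)) / 2) * ‖v‖ ^ 2)) := by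
    intro n
    induction n with
    | zero =>
      refine ⟨?_, fun t y v => ?_⟩
      · have e : (fun z : ℝ × UnitAddTorus d × EuclideanSpace ℝ d =>
            (Φ^[0] 0) z.1 z.2.1 z.2.2) = fun _ => 0 := by
          funext z
          simp only [Function.iterate_zero_apply, Pi.zero_apply]
        rw [e]
        exact continuous_const
      · simp only [Function.iterate_zero_apply, Pi.zero_apply, abs_zero]
        exact mul_nonneg hR (exp_pos _).le
    | succ n ih =>
      refine ⟨?_, fun t y v => ?_⟩
      · have h := continuous_picard hQa ih.1 (by positivity : 0 < β₀ / 2) (hweak ih.2) hf₀c T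
        simp only [Function.iterate_succ_apply', hΦ]
        exact h
      · rw [Function.iterate_succ_apply', hΦ]
        exact abs_picard_le hQa hT hβ₀ hlam hR hf₀b ih.1 ih.2 hsmall₁ t y v
  refine ⟨(hcb n).1, (hcb n).2, ?_⟩
  -- the geometric contraction, by induction
  induction n with
  | zero =>
    intro t y v
    have h := (hcb 1).2 t y v
    have e0 : (Φ^[0] 0) t y v = 0 := by
      simp only [Function.iterate_zero_apply, Pi.zero_apply]
    rw [zero_add, e0, sub_zero, pow_zero, mul_one]
    exact h
  | succ n ih =>
    intro t y v
    have hD : 0 ≤ R * (1 / 2) ^ n := by positivity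
    have h := abs_picard_sub_picard_le hQa hT hβ₀ hlam hR hD f₀ (hcb (n + 1)).1 (hcb n).1
      (hcb (n + 1)).2 (hcb n).2 ih t y v
    have e1 : (Φ^[n + 1 + 1] 0) t y v = Φ (Φ^[n + 1] 0) t y v := by
      rw [Function.iterate_succ_apply']
    have e2 : (Φ^[n + 1] 0) t y v = Φ (Φ^[n] 0) t y v := by
      rw [Function.iterate_succ_apply']
    rw [e1, e2, hΦ, hΦ]
    refine h.trans ?_
    have hG : 0 ≤ exp (-((β₀ - lam * max 0 (min T t)) / 2) * ‖v‖ ^ 2) := (exp_pos _).le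
    calc 4 * (sphereMeasure : Measure (sphere (0 : EuclideanSpace ℝ d) 1)).real univ *
          (∫ x : EuclideanSpace ℝ d, (1 + ‖x‖) * exp (-(β₀ / 2 / 2) * ‖x‖ ^ 2)) * R *
          (T + Real.sqrt (2 * T / lam)) * (R * (1 / 2) ^ n) *
          exp (-((β₀ - lam * max 0 (min T t)) / 2) * ‖v‖ ^ 2)
        ≤ (1 / 2) * (R * (1 / 2) ^ n) * exp (-((β₀ - lam * max 0 (min T t)) / 2) * ‖v‖ ^ 2) := by
          gcongr
      _ = R * (1 / 2) ^ (n + 1) * exp (-((β₀ - lam * max 0 (min T t)) / 2) * ‖v‖ ^ 2) := by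
          ring

/-- **The Picard iteration converges** (GST 2013 Part II Ch. 5, proof of Thm 7; here for the
sign-corrected Duhamel map of the equation): under the hypotheses of `picard_iterate_bounds`
there is a jointly continuous `u` in the ball `|u(t)| ≤ R e^{-β(t)|v|²/2}` with `Φ(u) = u`
(uniform limit of the iterates; the fixed-point identity by the Lipschitz estimate
`abs_picard_sub_picard_le`). [cite: GST2013, Part II Ch. 5 Thm 7] -/
theorem picard_fixedPoint_exists
    {Qa : (EuclideanSpace ℝ d → ℝ) → EuclideanSpace ℝ d → ℝ}
    (hQa : ∀ p v, Qa p v = ∫ w, ∫ ω, hardSphereKernel (v, w) ω *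
      (|p (collide ω (v, w)).1| * |p (collide ω (v, w)).2| - p v * |p w|) ∂sphereMeasure)
    {T β₀ lam R Kf : ℝ} (hT : 0 < T) (hβ₀ : 0 < β₀) (hlam : lam = β₀ / (2 * T)) (hR : 0 ≤ R)
    {f₀ : UnitAddTorus d → EuclideanSpace ℝ d → ℝ} (hf₀c : Continuous (Function.uncurry f₀))
    (hf₀b : ∀ y v, |f₀ y v| ≤ Kf * exp (-(β₀ / 2) * ‖v‖ ^ 2))
    (hsmall₁ : Kf + 4 * (sphereMeasure : Measure (sphere (0 : EuclideanSpace ℝ d) 1)).real univ *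
        (∫ x : EuclideanSpace ℝ d, (1 + ‖x‖) * exp (-(β₀ / 2 / 2) * ‖x‖ ^ 2)) * R * R *
        (T + Real.sqrt (2 * T / lam)) ≤ R)
    (hsmall₂ : 4 * (sphereMeasure : Measure (sphere (0 : EuclideanSpace ℝ d) 1)).real univ *
        (∫ x : EuclideanSpace ℝ d, (1 + ‖x‖) * exp (-(β₀ / 2 / 2) * ‖x‖ ^ 2)) * R *
        (T + Real.sqrt (2 * T / lam)) ≤ 1 / 2)
    {Φ : (ℝ → UnitAddTorus d → EuclideanSpace ℝ d → ℝ) → ℝ → UnitAddTorus d →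
      EuclideanSpace ℝ d → ℝ}
    (hΦ : ∀ u t y v, Φ u t y v =
      f₀ (y - Literature.Analysis.FunctionSpaces.Torus.proj (max 0 (min T t) • v)) v +
        ∫ τ in (0 : ℝ)..max 0 (min T t),
          Qa (u τ (y - Literature.Analysis.FunctionSpaces.Torus.proj
            ((max 0 (min T t) - τ) • v))) v) :
    ∃ u : ℝ → UnitAddTorus d → EuclideanSpace ℝ d → ℝ,
      Continuous (fun z : ℝ × UnitAddTorus d × EuclideanSpace ℝ d => u z.1 z.2.1 z.2.2) ∧
      (∀ t y v, |u t y v| ≤ R * exp (-((β₀ - lam * max 0 (min T t)) / 2) * ‖v‖ ^ 2)) ∧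
      ∀ t y v, Φ u t y v = u t y v := by
  have hL := picard_iterate_bounds hQa hT hβ₀ hlam hR hf₀c hf₀b hsmall₁ hsmall₂ hΦ
  set G : ℝ → EuclideanSpace ℝ d → ℝ := fun t v =>
    exp (-((β₀ - lam * max 0 (min T t)) / 2) * ‖v‖ ^ 2) with hG_def
  have hlam0 : 0 < lam := by rw [hlam]; positivity
  have hG0 : ∀ t v, 0 < G t v := fun t v => exp_pos _
  have hG1 : ∀ t v, G t v ≤ 1 := fun t v => by
    have hlamT : lam * T = β₀ / 2 := by rw [hlam]; field_simp
    have h1 : max 0 (min T t) ≤ T := max_le hT.le (min_le_left _ _)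
    have h2 : β₀ / 2 ≤ β₀ - lam * max 0 (min T t) := by
      nlinarith [mul_le_mul_of_nonneg_left h1 hlam0.le]
    simp only [hG_def]
    rw [exp_le_one_iff]
    nlinarith [sq_nonneg ‖v‖]
  -- geometric control of the iterates at each point
  have hdist : ∀ t y v (n : ℕ), dist ((Φ^[n] 0) t y v) ((Φ^[n + 1] 0) t y v) ≤
      (R * G t v) * (1 / 2) ^ n := fun t y v n => by
    rw [dist_comm, Real.dist_eq]
    calc |(Φ^[n + 1] 0) t y v - (Φ^[n] 0) t y v| ≤ R * (1 / 2) ^ n * G t v := (hL n).2.2 t y v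
      _ = (R * G t v) * (1 / 2) ^ n := by ring
  have hcauchy : ∀ t y v, CauchySeq fun n : ℕ => (Φ^[n] 0) t y v := fun t y v =>
    cauchySeq_of_le_geometric (1 / 2) (R * G t v) (by norm_num) (hdist t y v)
  set u : ℝ → UnitAddTorus d → EuclideanSpace ℝ d → ℝ := fun t y v =>
    limUnder atTop fun n : ℕ => (Φ^[n] 0) t y v with hu_def
  have hlim : ∀ t y v, Tendsto (fun n : ℕ => (Φ^[n] 0) t y v) atTop (𝓝 (u t y v)) := fun t y v =>
    tendsto_nhds_limUnder (cauchySeq_tendsto_of_complete (hcauchy t y v))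
  have herr : ∀ (n : ℕ) t y v, |(Φ^[n] 0) t y v - u t y v| ≤ 2 * R * (1 / 2) ^ n * G t v := by
    intro n t y v
    have h := dist_le_of_le_geometric_of_tendsto (1 / 2) (R * G t v) (by norm_num) (hdist t y v)
      (hlim t y v) n
    rw [Real.dist_eq] at h
    refine h.trans (le_of_eq ?_)
    ring
  -- continuity of the limit: the convergence is uniform
  have hu_cont : Continuous (fun z : ℝ × UnitAddTorus d × EuclideanSpace ℝ d => u z.1 z.2.1 z.2.2) := by
    have hunif : TendstoUniformly
        (fun (n : ℕ) (z : ℝ × UnitAddTorus d × EuclideanSpace ℝ d) => (Φ^[n] 0) z.1 z.2.1 z.2.2)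
        (fun z => u z.1 z.2.1 z.2.2) atTop := by
      refine Metric.tendstoUniformly_iff.2 fun ε hε => ?_
      obtain ⟨N, hN⟩ := exists_pow_lt_of_lt_one (div_pos hε (by positivity : (0 : ℝ) < 2 * R + 1))
        (by norm_num : (1 / 2 : ℝ) < 1)
      refine eventually_atTop.2 ⟨N, fun n hn z => ?_⟩
      rw [dist_comm, Real.dist_eq]
      have hpow : ((1 : ℝ) / 2) ^ n ≤ (1 / 2) ^ N :=
        pow_le_pow_of_le_one (by norm_num) (by norm_num) hn
      have hpos : 0 ≤ ((1 : ℝ) / 2) ^ n := by positivity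
      calc |(Φ^[n] 0) z.1 z.2.1 z.2.2 - u z.1 z.2.1 z.2.2| ≤ 2 * R * (1 / 2) ^ n * G z.1 z.2.2 :=
            herr n _ _ _
        _ ≤ 2 * R * (1 / 2) ^ n * 1 := by
            have := hG1 z.1 z.2.2
            have : 0 ≤ 2 * R * (1 / 2) ^ n := by positivity
            gcongr
        _ ≤ (2 * R + 1) * (1 / 2) ^ N := by
            nlinarith [mul_le_mul_of_nonneg_left hpow (by positivity : (0 : ℝ) ≤ 2 * R),
              pow_nonneg (by norm_num : (0 : ℝ) ≤ 1 / 2) N]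
        _ < (2 * R + 1) * (ε / (2 * R + 1)) := by gcongr
        _ = ε := by field_simp
    exact hunif.continuous (Eventually.of_forall fun n => (hL n).1).frequently
  -- the ball
  have hu_bound : ∀ t y v, |u t y v| ≤ R * G t v := fun t y v =>
    le_of_tendsto' ((continuous_abs.tendsto _).comp (hlim t y v)) fun n => (hL n).2.1 t y v
  refine ⟨u, hu_cont, hu_bound, fun t y v => ?_⟩
  -- the fixed-point identity
  have h1 : Tendsto (fun n => (Φ^[n + 1] 0) t y v) atTop (𝓝 (u t y v)) :=
    (hlim t y v).comp (tendsto_add_atTop_nat 1)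
  have h2 : Tendsto (fun n => (Φ^[n + 1] 0) t y v) atTop (𝓝 (Φ u t y v)) := by
    refine Metric.tendsto_atTop.2 fun ε hε => ?_
    obtain ⟨N, hN⟩ := exists_pow_lt_of_lt_one (div_pos hε (by positivity : (0 : ℝ) < R + 1))
      (by norm_num : (1 / 2 : ℝ) < 1)
    refine ⟨N, fun n hn => ?_⟩
    have hD : 0 ≤ 2 * R * (1 / 2) ^ n := by positivity
    have hb := abs_picard_sub_picard_le hQa hT hβ₀ hlam hR hD f₀ (hL n).1 hu_cont (hL n).2.1
      hu_bound (herr n) t y v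
    have hstep : (Φ^[n + 1] 0) t y v = Φ (Φ^[n] 0) t y v := by
      rw [Function.iterate_succ_apply']
    rw [Real.dist_eq, hstep, hΦ, hΦ]
    refine lt_of_le_of_lt hb ?_
    have hpow : ((1 : ℝ) / 2) ^ n ≤ (1 / 2) ^ N :=
      pow_le_pow_of_le_one (by norm_num) (by norm_num) hn
    calc 4 * (sphereMeasure : Measure (sphere (0 : EuclideanSpace ℝ d) 1)).real univ *
          (∫ x : EuclideanSpace ℝ d, (1 + ‖x‖) * exp (-(β₀ / 2 / 2) * ‖x‖ ^ 2)) * R *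
          (T + Real.sqrt (2 * T / lam)) * (2 * R * (1 / 2) ^ n) * G t v
        ≤ (1 / 2) * (2 * R * (1 / 2) ^ n) * 1 := by
          have hG1' : exp (-((β₀ - lam * max 0 (min T t)) / 2) * ‖v‖ ^ 2) ≤ 1 := hG1 t v
          have hG0' : 0 ≤ exp (-((β₀ - lam * max 0 (min T t)) / 2) * ‖v‖ ^ 2) := (hG0 t v).le
          gcongr
      _ ≤ (R + 1) * (1 / 2) ^ N := by
          nlinarith [mul_le_mul_of_nonneg_left hpow hR, pow_nonneg (by norm_num : (0 : ℝ) ≤ 1 / 2) N]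
      _ < (R + 1) * (ε / (R + 1)) := by gcongr
      _ = ε := by field_simp
  exact tendsto_nhds_unique h2 h1

/-- **Positivity of the fixed point** (Kaniel–Shinbrot 1978 §2; the order argument replacing
the monotone scheme). Let `u` be jointly continuous with a Gaussian bound and satisfy the
sign-corrected Duhamel identity along characteristics,
`u(t, x + tv, v) = f₀(x, v) + ∫₀ᵗ Q̃(u(τ, x + τv, ·))(v) dτ` on `[0, T]`, with `f₀ ≥ 0`. Then
`u(t) ≥ 0` for `t ∈ [0, T]`: at the last time `s₀` before a negative value where `u♯ ≥ 0` one
has `u♯(s₀) = 0`, and on `(s₀, t₁]` the integrand `Q̃♯ ≥ 0` (`absCollision_nonneg_of_nonpos`),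
so `u♯(t₁) ≥ u♯(s₀) = 0`. [folklore] -/
theorem picard_fixedPoint_nonneg
    {Qa : (EuclideanSpace ℝ d → ℝ) → EuclideanSpace ℝ d → ℝ}
    (hQa : ∀ p v, Qa p v = ∫ w, ∫ ω, hardSphereKernel (v, w) ω *
      (|p (collide ω (v, w)).1| * |p (collide ω (v, w)).2| - p v * |p w|) ∂sphereMeasure)
    {T R γ : ℝ} (hγ : 0 < γ) {f₀ : UnitAddTorus d → EuclideanSpace ℝ d → ℝ}
    (hf₀nn : ∀ x v, 0 ≤ f₀ x v) {u : ℝ → UnitAddTorus d → EuclideanSpace ℝ d → ℝ}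
    (hu : Continuous fun z : ℝ × UnitAddTorus d × EuclideanSpace ℝ d => u z.1 z.2.1 z.2.2)
    (hub : ∀ t y v, |u t y v| ≤ R * exp (-(γ / 2) * ‖v‖ ^ 2))
    (hchar : ∀ x v, ∀ t ∈ Icc 0 T, u t (x + Literature.Analysis.FunctionSpaces.Torus.proj (t • v)) v =
      f₀ x v + ∫ τ in (0 : ℝ)..t,
        Qa (u τ (x + Literature.Analysis.FunctionSpaces.Torus.proj (τ • v))) v) :
    ∀ t ∈ Icc 0 T, ∀ y v, 0 ≤ u t y v := by
  have hF := continuous_absCollision_slice hQa hu hγ hub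
  have hπ := Literature.Analysis.FunctionSpaces.Torus.continuous_proj (d := d)
  -- reduce to characteristics
  suffices hsuff : ∀ x v, ∀ t ∈ Icc 0 T,
      0 ≤ u t (x + Literature.Analysis.FunctionSpaces.Torus.proj (t • v)) v by
    intro t ht y v
    have h := hsuff (y - Literature.Analysis.FunctionSpaces.Torus.proj (t • v)) v t ht
    rwa [sub_add_cancel] at h
  intro x v
  set Y : ℝ → ℝ := fun t => u t (x + Literature.Analysis.FunctionSpaces.Torus.proj (t • v)) v
    with hY_def
  set A : ℝ → ℝ := fun t =>
    Qa (u t (x + Literature.Analysis.FunctionSpaces.Torus.proj (t • v))) v with hA_def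
  have hcurve : Continuous fun t : ℝ =>
      ((t, x + Literature.Analysis.FunctionSpaces.Torus.proj (t • v), v) :
        ℝ × UnitAddTorus d × EuclideanSpace ℝ d) := by fun_prop
  have hYc : Continuous Y := hu.comp hcurve
  have hAc : Continuous A := hF.comp hcurve
  have hYeq : ∀ t ∈ Icc 0 T, Y t = f₀ x v + ∫ τ in (0 : ℝ)..t, A τ := hchar x v
  have hApos : ∀ t, Y t ≤ 0 → 0 ≤ A t := fun t hYt =>
    absCollision_nonneg_of_nonpos hQa
      (p := u t (x + Literature.Analysis.FunctionSpaces.Torus.proj (t • v))) (v := v) hYt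
  -- the claim along the characteristic, by contradiction
  intro t₁ ht₁
  have h0T : (0 : ℝ) ∈ Icc 0 T := ⟨le_rfl, ht₁.1.trans ht₁.2⟩
  have hY0 : Y 0 = f₀ x v := by
    have h := hYeq 0 h0T
    simpa using h
  show 0 ≤ Y t₁
  by_contra hneg
  push Not at hneg
  set Z : Set ℝ := Icc 0 t₁ ∩ {s | 0 ≤ Y s} with hZ_def
  have hZ0 : (0 : ℝ) ∈ Z := ⟨⟨le_rfl, ht₁.1⟩, by
    show 0 ≤ Y 0
    rw [hY0]; exact hf₀nn x v⟩
  have hZbdd : BddAbove Z := ⟨t₁, fun s hs => hs.1.2⟩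
  have hZclosed : IsClosed Z := isClosed_Icc.inter (isClosed_le continuous_const hYc)
  set s₀ : ℝ := sSup Z with hs₀_def
  have hs₀Z : s₀ ∈ Z := hZclosed.csSup_mem ⟨0, hZ0⟩ hZbdd
  have hs₀_ge : ∀ s ∈ Z, s ≤ s₀ := fun s hs => le_csSup hZbdd hs
  have hs₀t₁ : s₀ ≤ t₁ := hs₀Z.1.2
  have hYs₀_nonneg : 0 ≤ Y s₀ := hs₀Z.2
  have hs₀lt : s₀ < t₁ := lt_of_le_of_ne hs₀t₁ fun h => by
    rw [h] at hYs₀_nonneg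
    exact absurd hYs₀_nonneg (not_le.2 hneg)
  have hYneg : ∀ s, s₀ < s → s ≤ t₁ → Y s < 0 := fun s hs hst₁ => by
    by_contra h
    push Not at h
    exact absurd (hs₀_ge s ⟨⟨hs₀Z.1.1.trans hs.le, hst₁⟩, h⟩) (not_le.2 hs)
  -- `Y s₀ = 0` by continuity and maximality
  have hYs₀ : Y s₀ = 0 := by
    refine le_antisymm ?_ hYs₀_nonneg
    by_contra hpos
    push Not at hpos
    obtain ⟨δ, hδ, hδY⟩ := Metric.continuousAt_iff.1 hYc.continuousAt (Y s₀) hpos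
    set s : ℝ := min (s₀ + δ / 2) t₁ with hs_def
    have hs1 : s₀ < s := lt_min (by linarith) hs₀lt
    have hs2 : s ≤ t₁ := min_le_right _ _
    have hs3 : dist s s₀ < δ := by
      rw [Real.dist_eq, abs_of_pos (sub_pos.2 hs1)]
      linarith [min_le_left (s₀ + δ / 2) t₁]
    have h := hδY hs3
    rw [Real.dist_eq, abs_lt] at h
    have hYs : 0 < Y s := by linarith [h.1]
    exact absurd (hYneg s hs1 hs2) (not_lt.2 hYs.le)
  -- integrate the sign information on `[s₀, t₁]`
  have hs₀T : s₀ ∈ Icc 0 T := ⟨hs₀Z.1.1, hs₀t₁.trans ht₁.2⟩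
  have hdiff : Y t₁ - Y s₀ = ∫ τ in s₀..t₁, A τ := by
    rw [hYeq t₁ ht₁, hYeq s₀ hs₀T, add_sub_add_left_eq_sub,
      intervalIntegral.integral_interval_sub_left (hAc.intervalIntegrable _ _)
        (hAc.intervalIntegrable _ _)]
  have hint : 0 ≤ ∫ τ in s₀..t₁, A τ :=
    intervalIntegral.integral_nonneg hs₀t₁ fun τ hτ => by
      rcases hτ.1.eq_or_lt with h | h
      · rw [← h]
        exact hApos s₀ hYs₀.le
      · exact hApos τ (hYneg τ h hτ.2).le
  linarith

/-- **A nonnegative fixed point of the sign-corrected Duhamel map is a mild solution.** Let `u`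
be jointly continuous, in the weighted ball, and satisfy `Φ(u) = u` for the time-clamped Picard
map of `LanfordPicard` with datum `f₀ ≥ 0`. Then `u ≥ 0` on `[0, T]`
(`picard_fixedPoint_nonneg`), hence `Q̃(u(τ, y, ·)) = Q(u, u)(τ, y, ·)` there
(`absCollision_eq_collisionOpWith`), and Duhamel's formula along the free flow of the torus
holds: `u` is a mild solution of the hard-sphere Boltzmann equation on `[0, T]` with
`u(0) = f₀` (GST 2013 §2.1, Def. of mild solutions; Part I Ch. 2 §3.1 Thm 1). [cite: GST2013, Part I Ch. 2 §3.1 Thm 1] -/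
theorem picard_fixedPoint_isMild
    {Qa : (EuclideanSpace ℝ d → ℝ) → EuclideanSpace ℝ d → ℝ}
    (hQa : ∀ p v, Qa p v = ∫ w, ∫ ω, hardSphereKernel (v, w) ω *
      (|p (collide ω (v, w)).1| * |p (collide ω (v, w)).2| - p v * |p w|) ∂sphereMeasure)
    {T R γ : ℝ} (hT : 0 ≤ T) (hγ : 0 < γ) {f₀ : UnitAddTorus d → EuclideanSpace ℝ d → ℝ}
    (hf₀nn : ∀ x v, 0 ≤ f₀ x v) {u : ℝ → UnitAddTorus d → EuclideanSpace ℝ d → ℝ}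
    (hu : Continuous fun z : ℝ × UnitAddTorus d × EuclideanSpace ℝ d => u z.1 z.2.1 z.2.2)
    (hub : ∀ t y v, |u t y v| ≤ R * exp (-(γ / 2) * ‖v‖ ^ 2))
    (hfix : ∀ t y v,
      f₀ (y - Literature.Analysis.FunctionSpaces.Torus.proj (max 0 (min T t) • v)) v +
        ∫ τ in (0 : ℝ)..max 0 (min T t),
          Qa (u τ (y - Literature.Analysis.FunctionSpaces.Torus.proj
            ((max 0 (min T t) - τ) • v))) v = u t y v) :
    IsMildBoltzmannSolutionOn T (Torus.geometry d) hardSphereKernel u ∧ u 0 = f₀ := by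
  have hF := continuous_absCollision_slice hQa hu hγ hub
  have hπ := Literature.Analysis.FunctionSpaces.Torus.continuous_proj (d := d)
  have hclamp : ∀ t ∈ Icc 0 T, max 0 (min T t) = t := fun t ht => by
    rw [min_eq_right ht.2, max_eq_right ht.1]
  have hproj_sub : ∀ a b : EuclideanSpace ℝ d,
      Literature.Analysis.FunctionSpaces.Torus.proj (a - b) =
        Literature.Analysis.FunctionSpaces.Torus.proj a -
          Literature.Analysis.FunctionSpaces.Torus.proj b := fun a b => by
    rw [sub_eq_add_neg, Literature.Analysis.FunctionSpaces.Torus.proj_add,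
      Literature.Analysis.FunctionSpaces.Torus.proj_neg, ← sub_eq_add_neg]
  -- the Duhamel identity along characteristics, with the sign-corrected operator
  have hchar : ∀ x v, ∀ t ∈ Icc 0 T,
      u t (x + Literature.Analysis.FunctionSpaces.Torus.proj (t • v)) v =
        f₀ x v + ∫ τ in (0 : ℝ)..t,
          Qa (u τ (x + Literature.Analysis.FunctionSpaces.Torus.proj (τ • v))) v := by
    intro x v t ht
    have h := hfix t (x + Literature.Analysis.FunctionSpaces.Torus.proj (t • v)) v
    rw [hclamp t ht, add_sub_cancel_right] at h
    have e2 : ∀ τ : ℝ, x + Literature.Analysis.FunctionSpaces.Torus.proj (t • v) -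
        Literature.Analysis.FunctionSpaces.Torus.proj ((t - τ) • v) =
        x + Literature.Analysis.FunctionSpaces.Torus.proj (τ • v) := fun τ => by
      rw [sub_smul, hproj_sub]
      abel
    simp_rw [e2] at h
    exact h.symm
  have hcurve : ∀ (x : UnitAddTorus d) (v : EuclideanSpace ℝ d), Continuous fun τ : ℝ =>
      ((τ, x + Literature.Analysis.FunctionSpaces.Torus.proj (τ • v), v) :
        ℝ × UnitAddTorus d × EuclideanSpace ℝ d) := fun x v => by fun_prop
  -- the initial value
  have hu0 : ∀ x v, u 0 x v = f₀ x v := fun x v => by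
    have h := hchar x v 0 ⟨le_rfl, hT⟩
    simpa using h
  -- positivity
  have hnonneg : ∀ t ∈ Icc 0 T, ∀ y v, 0 ≤ u t y v :=
    picard_fixedPoint_nonneg hQa hγ hf₀nn hu hub hchar
  -- identification of the collision terms on `[0, T]`
  have hQ : ∀ x v, ∀ τ ∈ Icc 0 T,
      alongFlow (Torus.geometry d) (collisionTerm hardSphereKernel u) τ x v =
        Qa (u τ (x + Literature.Analysis.FunctionSpaces.Torus.proj (τ • v))) v := by
    intro x v τ hτ
    simp only [alongFlow, collisionTerm, Torus.geometry_translate]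
    exact (absCollision_eq_collisionOpWith hQa (fun w => hnonneg τ hτ _ w) v).symm
  refine ⟨⟨hnonneg, fun x v t ht => ?_, fun x v t ht => ?_⟩, funext fun y => funext fun v => hu0 y v⟩
  · -- interval integrability of the collision term along characteristics
    have hA : IntervalIntegrable (fun τ =>
        Qa (u τ (x + Literature.Analysis.FunctionSpaces.Torus.proj (τ • v))) v) volume 0 t :=
      ((hF.comp (hcurve x v)).intervalIntegrable _ _)
    refine hA.congr ?_
    intro τ hτ
    rw [uIoc_of_le ht.1] at hτ
    exact (hQ x v τ ⟨hτ.1.le, hτ.2.trans ht.2⟩).symm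
  · -- Duhamel's formula
    have lhs : alongFlow (Torus.geometry d) u t x v =
        u t (x + Literature.Analysis.FunctionSpaces.Torus.proj (t • v)) v := by
      simp only [alongFlow, Torus.geometry_translate]
    rw [lhs, hchar x v t ht, hu0 x v]
    congr 1
    refine intervalIntegral.integral_congr fun τ hτ => ?_
    rw [uIcc_of_le ht.1] at hτ
    exact (hQ x v τ ⟨hτ.1, hτ.2.trans ht.2⟩).symm

/-- **Local existence of mild hard-sphere Boltzmann solutions in Lanford's class on the torus**
(Gallagher–Saint-Raymond–Texier 2013, Part I Ch. 2 §3.1 Thm 1 — existence part — and Part II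
Ch. 5 Thm 7 / Remark 5.1.5 for the dependence of the time; Ukai 1974). For `β₀ > 0`, `K > 0`
there is `T = T(d, β₀, K) > 0` (here `T = 1/(16 |S^{d-1}| J(β₀/2) K (1 + (4/β₀)^{1/2}) + 1)`,
`J(γ) = ∫ (1 + |u|) e^{-γ|u|²/2} du`) such that every continuous `f₀` with
`0 ≤ f₀ ≤ K e^{-β₀|v|²/2}` admits a mild solution `u` of the hard-sphere Boltzmann equation on
`[0, T] × T^d` with `u(0) = f₀`, continuous time slices, and
`|u(t, x, v)| ≤ 2K e^{-(β₀/2)|v|²/2}` for all `t`. [cite: GST2013, Part I Ch. 2 §3.1 Thm 1] -/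
theorem hardSphere_mild_exists {β₀ K : ℝ} (hβ₀ : 0 < β₀) (hK : 0 < K) :
    ∃ T > (0 : ℝ), ∀ f₀ : UnitAddTorus d → EuclideanSpace ℝ d → ℝ, (∀ x v, 0 ≤ f₀ x v) →
      Continuous (Function.uncurry f₀) →
      (∀ x v, |f₀ x v| ≤ K * exp (-(β₀ / 2) * ‖v‖ ^ 2)) →
      ∃ u : ℝ → UnitAddTorus d → EuclideanSpace ℝ d → ℝ,
        IsMildBoltzmannSolutionOn T (Torus.geometry d) hardSphereKernel u ∧ u 0 = f₀ ∧
        (∀ t, Continuous (Function.uncurry (u t))) ∧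
        ∀ t y v, |u t y v| ≤ 2 * K * exp (-(β₀ / 2 / 2) * ‖v‖ ^ 2) := by
  -- constants
  set S : ℝ := (sphereMeasure : Measure (sphere (0 : EuclideanSpace ℝ d) 1)).real univ with hS
  set J : ℝ := ∫ x : EuclideanSpace ℝ d, (1 + ‖x‖) * exp (-(β₀ / 2 / 2) * ‖x‖ ^ 2) with hJ
  have hS0 : 0 ≤ S := measureReal_nonneg
  have hJ0 : 0 ≤ J := integral_one_add_norm_mul_exp_nonneg (β₀ / 2)
  set cβ : ℝ := Real.sqrt (4 / β₀) with hcβ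
  have hcβ0 : 0 ≤ cβ := Real.sqrt_nonneg _
  set A : ℝ := 16 * S * J * K * (1 + cβ) with hA_def
  have hA0 : 0 ≤ A := by positivity
  set T : ℝ := 1 / (A + 1) with hT_def
  have hT : 0 < T := by positivity
  have hAT : A * T ≤ 1 := by
    rw [hT_def, mul_one_div, div_le_one (by positivity)]
    linarith
  refine ⟨T, hT, fun f₀ hf₀nn hf₀c hf₀b => ?_⟩
  -- the scale and the smallness conditions
  set lam : ℝ := β₀ / (2 * T) with hlam
  have hε : T + Real.sqrt (2 * T / lam) = T * (1 + cβ) := by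
    have h1 : 2 * T / lam = T ^ 2 * (4 / β₀) := by
      rw [hlam]
      field_simp
      ring
    rw [h1, Real.sqrt_mul (sq_nonneg T), Real.sqrt_sq hT.le, hcβ]
    ring
  have hR : (0 : ℝ) ≤ 2 * K := by positivity
  have hsmall₂ : 4 * S * J * (2 * K) * (T + Real.sqrt (2 * T / lam)) ≤ 1 / 2 := by
    rw [hε]
    have : 4 * S * J * (2 * K) * (T * (1 + cβ)) = A * T / 2 := by
      simp only [hA_def]; ring
    rw [this]
    linarith
  have hsmall₁ : K + 4 * S * J * (2 * K) * (2 * K) * (T + Real.sqrt (2 * T / lam)) ≤ 2 * K := by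
    rw [hε]
    have : 4 * S * J * (2 * K) * (2 * K) * (T * (1 + cβ)) = K * (A * T) := by
      simp only [hA_def]; ring
    rw [this]
    nlinarith [mul_le_mul_of_nonneg_left hAT hK.le]
  -- the sign-corrected collision operator and the Picard map
  set Qa : (EuclideanSpace ℝ d → ℝ) → EuclideanSpace ℝ d → ℝ := fun p v =>
    ∫ w, ∫ ω, hardSphereKernel (v, w) ω *
      (|p (collide ω (v, w)).1| * |p (collide ω (v, w)).2| - p v * |p w|) ∂sphereMeasure
    with hQa_def
  have hQa : ∀ p v, Qa p v = ∫ w, ∫ ω, hardSphereKernel (v, w) ω *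
      (|p (collide ω (v, w)).1| * |p (collide ω (v, w)).2| - p v * |p w|) ∂sphereMeasure :=
    fun p v => rfl
  set Φ : (ℝ → UnitAddTorus d → EuclideanSpace ℝ d → ℝ) → ℝ → UnitAddTorus d →
      EuclideanSpace ℝ d → ℝ := fun u t y v =>
    f₀ (y - Literature.Analysis.FunctionSpaces.Torus.proj (max 0 (min T t) • v)) v +
      ∫ τ in (0 : ℝ)..max 0 (min T t),
        Qa (u τ (y - Literature.Analysis.FunctionSpaces.Torus.proj
          ((max 0 (min T t) - τ) • v))) v with hΦ_def
  have hΦ : ∀ u t y v, Φ u t y v =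
      f₀ (y - Literature.Analysis.FunctionSpaces.Torus.proj (max 0 (min T t) • v)) v +
        ∫ τ in (0 : ℝ)..max 0 (min T t),
          Qa (u τ (y - Literature.Analysis.FunctionSpaces.Torus.proj
            ((max 0 (min T t) - τ) • v))) v := fun _ _ _ _ => rfl
  obtain ⟨u, hu, hub, hfix⟩ := picard_fixedPoint_exists hQa hT hβ₀ hlam hR hf₀c hf₀b hsmall₁
    hsmall₂ hΦ
  -- the global Gaussian bound at the weight `β₀/2`
  have hlam0 : 0 < lam := by rw [hlam]; positivity
  have hub' : ∀ t y v, |u t y v| ≤ 2 * K * exp (-(β₀ / 2 / 2) * ‖v‖ ^ 2) := by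
    intro t y v
    refine (hub t y v).trans (mul_le_mul_of_nonneg_left (exp_le_exp.2 ?_) hR)
    have hlamT : lam * T = β₀ / 2 := by rw [hlam]; field_simp
    have h1 : max 0 (min T t) ≤ T := max_le hT.le (min_le_left _ _)
    have h2 : β₀ / 2 ≤ β₀ - lam * max 0 (min T t) := by
      nlinarith [mul_le_mul_of_nonneg_left h1 hlam0.le]
    nlinarith [sq_nonneg ‖v‖]
  obtain ⟨hmild, hu0⟩ := picard_fixedPoint_isMild hQa hT.le (by positivity : 0 < β₀ / 2) hf₀nn
    hu hub' (fun t y v => (hΦ u t y v).symm.trans (hfix t y v))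
  have hslice : ∀ t, Continuous (Function.uncurry (u t)) := fun t =>
    (hu.comp (continuous_const.prodMk continuous_id) :
      Continuous fun p : UnitAddTorus d × EuclideanSpace ℝ d => u t p.1 p.2)
  exact ⟨u, hmild, hu0, hslice, hub'⟩

end Existence

end

end Literature.MathematicalPhysics.KineticTheory
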